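import Literature.Barriers.CriticalPhenomena.PlanarEdwardsModelDiffusive
import Literature.Probability.Process.BrownianIncrementGaussFunctional
import Mathlib.MeasureTheory.Function.StronglyMeasurable.Basic
import Mathlib.MeasureTheory.Integral.Prod
import HarnessLib

/-!
# Mollified self-intersection local time of planar Brownian motion: first and second moments
# (Varadhan's second-moment computation, step 1)

Sibling file of `Literature.Barriers.CriticalPhenomena.PlanarEdwardsModelDiffusive` towards the
discharge of `Edwards2D.Varadhan1969_l2Convergence` (the `L²` half of
`Edwards2D.Varadhan1969_renormalisation`; see `PlanarEdwardsModelDiffusiveVaradhan`). For a planar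
Brownian motion `Z` (`Literature.Probability.Process.IsBrownianComplex`, measurable marginals,
continuous paths) and Le Gall's kernels `g_k(y) = (k/2π) e^{-k|y|²/2}` (`Edwards2D.gaussKernel`), the
mollified self-intersection local time `T_k = ∫₀¹∫₀¹ g_k(Z_s - Z_t) ds dt`
(`Edwards2D.mollifiedSILT`) is rewritten as an integral over the unit square of the bounded,
jointly measurable kernel process `H_k((s,t), ω) = g_k(Z_t ω - Z_s ω)` (`Edwards2D.kernelProc`,
`Edwards2D.unitSq`, `mollifiedSILT_eq_integral_kernelProc`), whence by Fubini and the Gaussian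
computation `Literature.Probability.Process.IsBrownianComplex.integral_exp_neg_normSq_increments`:

* `integral_kernelProc` — `E g_k(Z_t - Z_s) = (k/2π)/(1 + k|t - s|)` (`= p_{1/k+|t-s|}(0)`, Le Gall's
  (2-a));
* `integral_kernelProc_mul` — `E g_k(Z_t - Z_s) g_l(Z_v - Z_u) = (kl/(2π)²)/D`,
  `D = (1 + k|t-s|)(1 + l|v-u|) - kl c²`, `c = incrCov s t u v` the covariance of the increments;
* `integral_mollifiedSILT`, `integral_mollifiedSILT_mul`, and
  **`covariance_mollifiedSILT`**: `Cov(T_k, T_l) = ∫_{[0,1]⁴} Φ_{k,l}` with the explicit covariance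
  density `Edwards2D.covDensity k l` (`(kl/(2π)²)(1/D - 1/((1+k|t-s|)(1+l|v-u|)))`).

Also: measurability and boundedness of `T_k` (`measurable_mollifiedSILT`, `mollifiedSILT_le`).

## References

* S. R. S. Varadhan, Appendix to K. Symanzik, *Euclidean quantum field theory* (1969) (the
  second-moment method; not consulted, cited through Le Gall 1985).
* J.-F. Le Gall, Sém. Prob. XIX, LNM 1123 (1985), 314–331, §0 and (2-a).
-/

noncomputable section

open MeasureTheory ProbabilityTheory Real Filter Set Function
open scoped NNReal ENNReal Topology

namespace Literature.Barriers.CriticalPhenomena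

namespace Edwards2D

open Literature.Probability.Process

universe u

variable {Ω : Type u} {Z : ℝ≥0 → Ω → ℂ}

/-! ### The kernels `g_k` -/

/-- `g_k ≥ 0`. [cite: LeGall1985, §0 (definition of g_k)] -/
theorem gaussKernel_nonneg (k : ℕ) (z : ℂ) : 0 ≤ gaussKernel k z := by
  unfold gaussKernel
  positivity

/-- `g_k ≤ g_k(0) = k/2π`. [cite: LeGall1985, §0 (definition of g_k)] -/
theorem gaussKernel_le (k : ℕ) (z : ℂ) : gaussKernel k z ≤ k / (2 * π) := by
  unfold gaussKernel
  have h1 : rexp (-((k : ℝ) * ‖z‖ ^ 2 / 2)) ≤ 1 := by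
    rw [Real.exp_le_one_iff]
    have : 0 ≤ (k : ℝ) * ‖z‖ ^ 2 / 2 := by positivity
    linarith
  have h2 : (0 : ℝ) ≤ k / (2 * π) := by positivity
  calc (k : ℝ) / (2 * π) * rexp (-((k : ℝ) * ‖z‖ ^ 2 / 2)) ≤ k / (2 * π) * 1 :=
        mul_le_mul_of_nonneg_left h1 h2
    _ = _ := mul_one _

/-- `|g_k| ≤ k/2π`. [cite: LeGall1985, §0 (definition of g_k)] -/
theorem norm_gaussKernel_le (k : ℕ) (z : ℂ) : ‖gaussKernel k z‖ ≤ k / (2 * π) := by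
  rw [Real.norm_eq_abs, abs_of_nonneg (gaussKernel_nonneg k z)]
  exact gaussKernel_le k z

/-- `g_k` is continuous. [cite: LeGall1985, §0 (definition of g_k)] -/
theorem continuous_gaussKernel (k : ℕ) : Continuous (gaussKernel k) := by
  unfold gaussKernel
  fun_prop

/-- `g_k` is even. [cite: LeGall1985, §0 (definition of g_k)] -/
theorem gaussKernel_neg (k : ℕ) (z : ℂ) : gaussKernel k (-z) = gaussKernel k z := by
  simp [gaussKernel, norm_neg]

/-- `g_k` in the form `(k/2π) exp(-(k|z|²)/2)` of
`Literature.Probability.Process.IsBrownianComplex.integral_exp_neg_normSq_increments`.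
[cite: LeGall1985, §0 (definition of g_k)] -/
theorem gaussKernel_eq (k : ℕ) (z : ℂ) :
    gaussKernel k z = k / (2 * π) * rexp (-((k : ℝ) * ‖z‖ ^ 2) / 2) := by
  rw [gaussKernel, neg_div]

/-! ### The kernel process `H_k((s,t), ω) = g_k(Z_t ω - Z_s ω)` on the unit square -/

/-- The kernel process `H_k((s,t), ω) = g_k(Z_t ω - Z_s ω)` (real times clamped to `ℝ≥0` by
`Real.toNNReal`, the parametrisation of `Edwards2D.mollifiedSILT`); `T_k = ∫_{[0,1]²} H_k`
(`mollifiedSILT_eq_integral_kernelProc`). [cite: LeGall1985, §0, (0-b)] -/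
def kernelProc (Z : ℝ≥0 → Ω → ℂ) (k : ℕ) (p : ℝ × ℝ) (ω : Ω) : ℝ :=
  gaussKernel k (Z p.2.toNNReal ω - Z p.1.toNNReal ω)

/-- Lebesgue measure on the unit square `[0,1]²` (as a measure on `ℝ × ℝ`), the time-pair measure
of `T_k = ∫₀¹∫₀¹ …`. [cite: LeGall1985, §0, (0-b)] -/
def unitSq : Measure (ℝ × ℝ) :=
  (volume.restrict (Icc (0 : ℝ) 1)).prod (volume.restrict (Icc (0 : ℝ) 1))

/-- Lebesgue measure on `[0,1]` is a probability measure. [folklore] -/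
theorem isProbabilityMeasure_restrict_unitInterval :
    IsProbabilityMeasure (volume.restrict (Icc (0 : ℝ) 1) : Measure ℝ) :=
  ⟨by rw [Measure.restrict_apply_univ, Real.volume_Icc]; simp⟩

/-- `unitSq` is a probability measure (`[0,1]²` has area one). [folklore] -/
instance isProbabilityMeasure_unitSq : IsProbabilityMeasure unitSq := by
  have := isProbabilityMeasure_restrict_unitInterval
  unfold unitSq
  infer_instance

/-- `H_k ≥ 0`. [folklore] -/
theorem kernelProc_nonneg (Z : ℝ≥0 → Ω → ℂ) (k : ℕ) (p : ℝ × ℝ) (ω : Ω) : 0 ≤ kernelProc Z k p ω :=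
  gaussKernel_nonneg _ _

/-- `|H_k| ≤ k/2π`. [folklore] -/
theorem norm_kernelProc_le (Z : ℝ≥0 → Ω → ℂ) (k : ℕ) (p : ℝ × ℝ) (ω : Ω) :
    ‖kernelProc Z k p ω‖ ≤ k / (2 * π) :=
  norm_gaussKernel_le _ _

/-- For continuous paths, `H_k(·, ω)` is continuous on the time square. [folklore] -/
theorem continuous_kernelProc (hcont : ∀ ω, Continuous (Z · ω)) (k : ℕ) (ω : Ω) :
    Continuous fun p : ℝ × ℝ => kernelProc Z k p ω := by
  unfold kernelProc
  have h1 : Continuous fun p : ℝ × ℝ => Z p.2.toNNReal ω :=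
    (hcont ω).comp (continuous_real_toNNReal.comp continuous_snd)
  have h2 : Continuous fun p : ℝ × ℝ => Z p.1.toNNReal ω :=
    (hcont ω).comp (continuous_real_toNNReal.comp continuous_fst)
  exact (continuous_gaussKernel k).comp (h1.sub h2)

/-- `H_k(·, ω)` is integrable on the unit square. [folklore] -/
theorem integrable_kernelProc_unitSq (hcont : ∀ ω, Continuous (Z · ω)) (k : ℕ) (ω : Ω) :
    Integrable (fun p => kernelProc Z k p ω) unitSq :=
  Integrable.of_bound (continuous_kernelProc hcont k ω).aestronglyMeasurable _
    (ae_of_all _ fun p => norm_kernelProc_le Z k p ω)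

/-- **`T_k = ∫_{[0,1]²} H_k`**: the iterated integral defining `Edwards2D.mollifiedSILT` is the
integral of the kernel process over the unit square (Fubini; `g_k` is even).
[cite: LeGall1985, §0, (0-b)] -/
theorem mollifiedSILT_eq_integral_kernelProc (hcont : ∀ ω, Continuous (Z · ω)) (k : ℕ) (ω : Ω) :
    mollifiedSILT Z k ω = ∫ p, kernelProc Z k p ω ∂unitSq := by
  rw [unitSq, integral_prod _ (integrable_kernelProc_unitSq hcont k ω), mollifiedSILT]
  refine integral_congr_ae (ae_of_all _ fun s => integral_congr_ae (ae_of_all _ fun t => ?_))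
  simp only [kernelProc]
  rw [← gaussKernel_neg, neg_sub]

/-- `0 ≤ T_k`. [folklore] -/
theorem mollifiedSILT_nonneg (hcont : ∀ ω, Continuous (Z · ω)) (k : ℕ) (ω : Ω) :
    0 ≤ mollifiedSILT Z k ω := by
  rw [mollifiedSILT_eq_integral_kernelProc hcont]
  exact integral_nonneg fun p => kernelProc_nonneg Z k p ω

/-- `T_k ≤ k/2π`. [folklore] -/
theorem mollifiedSILT_le (hcont : ∀ ω, Continuous (Z · ω)) (k : ℕ) (ω : Ω) :
    mollifiedSILT Z k ω ≤ k / (2 * π) := by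
  rw [mollifiedSILT_eq_integral_kernelProc hcont]
  calc ∫ p, kernelProc Z k p ω ∂unitSq ≤ ∫ _p, (k : ℝ) / (2 * π) ∂unitSq := by
        refine integral_mono (integrable_kernelProc_unitSq hcont k ω) (integrable_const _) ?_
        intro p
        have := norm_kernelProc_le Z k p ω
        rw [Real.norm_eq_abs, abs_of_nonneg (kernelProc_nonneg Z k p ω)] at this
        exact this
    _ = k / (2 * π) := by simp

/-- `|T_k| ≤ k/2π`. [folklore] -/
theorem norm_mollifiedSILT_le (hcont : ∀ ω, Continuous (Z · ω)) (k : ℕ) (ω : Ω) :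
    ‖mollifiedSILT Z k ω‖ ≤ k / (2 * π) := by
  rw [Real.norm_eq_abs, abs_of_nonneg (mollifiedSILT_nonneg hcont k ω)]
  exact mollifiedSILT_le hcont k ω

section Measurable

variable [MeasurableSpace Ω] {P : Measure Ω}

/-- With measurable marginals, `H_k(p, ·)` is measurable for every time pair `p`. [folklore] -/
theorem measurable_kernelProc (hmeas : ∀ t, Measurable (Z t)) (k : ℕ) (p : ℝ × ℝ) :
    Measurable (kernelProc Z k p) := by
  unfold kernelProc
  exact (continuous_gaussKernel k).measurable.comp ((hmeas _).sub (hmeas _))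

/-- **Joint measurability** of `(p, ω) ↦ H_k(p, ω)` (continuous in `p`, measurable in `ω`:
Mathlib's `measurable_uncurry_of_continuous_of_measurable`). [folklore] -/
theorem measurable_uncurry_kernelProc (hmeas : ∀ t, Measurable (Z t))
    (hcont : ∀ ω, Continuous (Z · ω)) (k : ℕ) : Measurable (uncurry (kernelProc Z k)) :=
  measurable_uncurry_of_continuous_of_measurable (u := kernelProc Z k)
    (fun ω => continuous_kernelProc hcont k ω) (measurable_kernelProc hmeas k)

/-- `T_k` is measurable (the kernel process is jointly measurable). [folklore] -/
theorem measurable_mollifiedSILT (hmeas : ∀ t, Measurable (Z t)) (hcont : ∀ ω, Continuous (Z · ω))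
    (k : ℕ) : Measurable (mollifiedSILT Z k) := by
  have h : (mollifiedSILT Z k) = fun ω => ∫ p, kernelProc Z k p ω ∂unitSq :=
    funext fun ω => mollifiedSILT_eq_integral_kernelProc hcont k ω
  rw [h]
  exact ((measurable_uncurry_kernelProc hmeas hcont k).stronglyMeasurable.integral_prod_left
    (μ := unitSq)).measurable

/-- `T_k` is bounded and measurable, hence in every `Lᵖ(P)` of a finite measure. [folklore] -/
theorem memLp_mollifiedSILT [IsFiniteMeasure P] (hmeas : ∀ t, Measurable (Z t))
    (hcont : ∀ ω, Continuous (Z · ω)) (k : ℕ) (q : ℝ≥0∞) : MemLp (mollifiedSILT Z k) q P :=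
  MemLp.of_bound (measurable_mollifiedSILT hmeas hcont k).aestronglyMeasurable _
    (ae_of_all _ fun ω => norm_mollifiedSILT_le hcont k ω)

/-- `T_k` is integrable. [folklore] -/
theorem integrable_mollifiedSILT [IsFiniteMeasure P] (hmeas : ∀ t, Measurable (Z t))
    (hcont : ∀ ω, Continuous (Z · ω)) (k : ℕ) : Integrable (mollifiedSILT Z k) P :=
  Integrable.of_bound (measurable_mollifiedSILT hmeas hcont k).aestronglyMeasurable _
    (ae_of_all _ fun ω => norm_mollifiedSILT_le hcont k ω)

/-! ### Expectations of the kernel process (the Gaussian computation) -/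

/-- **First moment of the kernel process**: `E g_k(Z_t - Z_s) = (k/2π)/(1 + k|t - s|)`
(`= p_{1/k + |t-s|}(0)` for the planar heat kernel; Le Gall's (2-a) at `y = 0`).
[cite: LeGall1985, §2, (2-a)] -/
theorem integral_kernelProc [IsProbabilityMeasure P] (hZ : IsBrownianComplex Z P)
    (hmeas : ∀ t, Measurable (Z t)) (k : ℕ) (p : ℝ × ℝ) :
    ∫ ω, kernelProc Z k p ω ∂P =
      k / (2 * π) / (1 + k * |((p.2.toNNReal : ℝ≥0) : ℝ) - p.1.toNNReal|) := by
  simp only [kernelProc, gaussKernel_eq]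
  rw [integral_const_mul, hZ.integral_exp_neg_normSq_increment hmeas _ _ (Nat.cast_nonneg k)]
  ring

/-- The discriminant `D = (1 + k|t-s|)(1 + l|v-u|) - kl c²` of the pair of increments is positive.
[folklore] -/
theorem discr_pos [IsProbabilityMeasure P] (hZ : IsBrownianComplex Z P)
    (hmeas : ∀ t, Measurable (Z t)) (k l : ℕ) (p q : ℝ × ℝ) :
    0 < (1 + k * |((p.2.toNNReal : ℝ≥0) : ℝ) - p.1.toNNReal|) *
        (1 + l * |((q.2.toNNReal : ℝ≥0) : ℝ) - q.1.toNNReal|) -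
      k * l * incrCov p.1.toNNReal p.2.toNNReal q.1.toNNReal q.2.toNNReal ^ 2 :=
  (hZ.integral_exp_neg_normSq_increments hmeas _ _ _ _ (Nat.cast_nonneg k) (Nat.cast_nonneg l)).1

/-- **Mixed second moment of the kernel process**:
`E g_k(Z_t - Z_s) g_l(Z_v - Z_u) = (kl/(2π)²)/((1 + k|t-s|)(1 + l|v-u|) - kl c²)`, `c = incrCov s t u v`.
[folklore] -/
theorem integral_kernelProc_mul [IsProbabilityMeasure P] (hZ : IsBrownianComplex Z P)
    (hmeas : ∀ t, Measurable (Z t)) (k l : ℕ) (p q : ℝ × ℝ) :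
    ∫ ω, kernelProc Z k p ω * kernelProc Z l q ω ∂P =
      k / (2 * π) * (l / (2 * π)) /
        ((1 + k * |((p.2.toNNReal : ℝ≥0) : ℝ) - p.1.toNNReal|) *
            (1 + l * |((q.2.toNNReal : ℝ≥0) : ℝ) - q.1.toNNReal|) -
          k * l * incrCov p.1.toNNReal p.2.toNNReal q.1.toNNReal q.2.toNNReal ^ 2) := by
  have h := (hZ.integral_exp_neg_normSq_increments hmeas p.1.toNNReal p.2.toNNReal q.1.toNNReal
    q.2.toNNReal (Nat.cast_nonneg k) (Nat.cast_nonneg l)).2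
  simp only [kernelProc, gaussKernel_eq]
  have hsplit : ∀ ω, (k : ℝ) / (2 * π) * rexp (-((k : ℝ) * ‖Z p.2.toNNReal ω - Z p.1.toNNReal ω‖ ^ 2) / 2) *
      ((l : ℝ) / (2 * π) * rexp (-((l : ℝ) * ‖Z q.2.toNNReal ω - Z q.1.toNNReal ω‖ ^ 2) / 2)) =
      (k : ℝ) / (2 * π) * ((l : ℝ) / (2 * π)) *
        rexp (-((k : ℝ) * ‖Z p.2.toNNReal ω - Z p.1.toNNReal ω‖ ^ 2 +
          (l : ℝ) * ‖Z q.2.toNNReal ω - Z q.1.toNNReal ω‖ ^ 2) / 2) := by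
    intro ω
    rw [neg_add, add_div, Real.exp_add]
    ring
  simp_rw [hsplit]
  rw [integral_const_mul, h]
  ring

/-! ### Moments of `T_k` -/

/-- Joint measurability of `(p, ω) ↦ H_k(p, ω)` on `unitSq × P` as an integrable function
(bounded). [folklore] -/
theorem integrable_uncurry_kernelProc [IsProbabilityMeasure P] (hmeas : ∀ t, Measurable (Z t))
    (hcont : ∀ ω, Continuous (Z · ω)) (k : ℕ) :
    Integrable (uncurry (kernelProc Z k)) (unitSq.prod P) :=
  Integrable.of_bound (measurable_uncurry_kernelProc hmeas hcont k).aestronglyMeasurable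
    (k / (2 * π)) (ae_of_all _ fun x => norm_kernelProc_le Z k x.1 x.2)

/-- **`E T_k = ∫_{[0,1]²} (k/2π)/(1 + k|t-s|) ds dt`** (Fubini and `integral_kernelProc`; of order
`(1/π) log k`, the divergent constants `c_k` of Varadhan's renormalisation).
[cite: LeGall1985, §0, (0-c) and §2, (2-b)] -/
theorem integral_mollifiedSILT [IsProbabilityMeasure P] (hZ : IsBrownianComplex Z P)
    (hmeas : ∀ t, Measurable (Z t)) (hcont : ∀ ω, Continuous (Z · ω)) (k : ℕ) :
    ∫ ω, mollifiedSILT Z k ω ∂P =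
      ∫ p : ℝ × ℝ, (k : ℝ) / (2 * π) / (1 + k * |((p.2.toNNReal : ℝ≥0) : ℝ) - p.1.toNNReal|) ∂unitSq := by
  simp_rw [mollifiedSILT_eq_integral_kernelProc hcont]
  rw [← integral_integral_swap (integrable_uncurry_kernelProc hmeas hcont k)]
  exact integral_congr_ae (ae_of_all _ fun p => integral_kernelProc hZ hmeas k p)

/-- The product of two kernel processes on `[0,1]⁴ × Ω` is integrable (bounded, measurable).
[folklore] -/
theorem integrable_uncurry_kernelProc_mul [IsProbabilityMeasure P] (hmeas : ∀ t, Measurable (Z t))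
    (hcont : ∀ ω, Continuous (Z · ω)) (k l : ℕ) :
    Integrable (uncurry fun (pq : (ℝ × ℝ) × (ℝ × ℝ)) ω => kernelProc Z k pq.1 ω * kernelProc Z l pq.2 ω)
      ((unitSq.prod unitSq).prod P) := by
  have hm : Measurable (uncurry fun (pq : (ℝ × ℝ) × (ℝ × ℝ)) ω =>
      kernelProc Z k pq.1 ω * kernelProc Z l pq.2 ω) := by
    have hπ1 : Measurable fun x : ((ℝ × ℝ) × (ℝ × ℝ)) × Ω => ((x.1.1, x.2) : (ℝ × ℝ) × Ω) :=
      (measurable_fst.comp measurable_fst).prodMk measurable_snd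
    have hπ2 : Measurable fun x : ((ℝ × ℝ) × (ℝ × ℝ)) × Ω => ((x.1.2, x.2) : (ℝ × ℝ) × Ω) :=
      (measurable_snd.comp measurable_fst).prodMk measurable_snd
    have h1 := (measurable_uncurry_kernelProc hmeas hcont k).comp hπ1
    have h2 := (measurable_uncurry_kernelProc hmeas hcont l).comp hπ2
    exact h1.mul h2
  refine Integrable.of_bound hm.aestronglyMeasurable (k / (2 * π) * (l / (2 * π)))
    (ae_of_all _ fun x => ?_)
  simp only [uncurry]
  rw [norm_mul]
  exact mul_le_mul (norm_kernelProc_le Z k _ _) (norm_kernelProc_le Z l _ _) (norm_nonneg _)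
    (by positivity)

/-- **`E[T_k T_l] = ∫_{[0,1]⁴} (kl/(2π)²)/D`** (the product of the two time integrals is an
integral over `[0,1]⁴`, Fubini, and `integral_kernelProc_mul`). [folklore] -/
theorem integral_mollifiedSILT_mul [IsProbabilityMeasure P] (hZ : IsBrownianComplex Z P)
    (hmeas : ∀ t, Measurable (Z t)) (hcont : ∀ ω, Continuous (Z · ω)) (k l : ℕ) :
    ∫ ω, mollifiedSILT Z k ω * mollifiedSILT Z l ω ∂P =
      ∫ pq : (ℝ × ℝ) × (ℝ × ℝ), (k : ℝ) / (2 * π) * (l / (2 * π)) /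
        ((1 + k * |((pq.1.2.toNNReal : ℝ≥0) : ℝ) - pq.1.1.toNNReal|) *
            (1 + l * |((pq.2.2.toNNReal : ℝ≥0) : ℝ) - pq.2.1.toNNReal|) -
          k * l * incrCov pq.1.1.toNNReal pq.1.2.toNNReal pq.2.1.toNNReal pq.2.2.toNNReal ^ 2)
        ∂(unitSq.prod unitSq) := by
  simp_rw [mollifiedSILT_eq_integral_kernelProc hcont]
  have hprod : ∀ ω, (∫ p, kernelProc Z k p ω ∂unitSq) * (∫ q, kernelProc Z l q ω ∂unitSq) =
      ∫ pq : (ℝ × ℝ) × (ℝ × ℝ), kernelProc Z k pq.1 ω * kernelProc Z l pq.2 ω ∂(unitSq.prod unitSq) :=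
    fun ω => (integral_prod_mul (μ := unitSq) (ν := unitSq) (fun p => kernelProc Z k p ω)
      (fun q => kernelProc Z l q ω)).symm
  simp_rw [hprod]
  rw [← integral_integral_swap (integrable_uncurry_kernelProc_mul hmeas hcont k l)]
  exact integral_congr_ae (ae_of_all _ fun pq => integral_kernelProc_mul hZ hmeas k l pq.1 pq.2)

/-- The second-moment density `(kl/(2π)²)/D` is measurable. [folklore] -/
theorem measurable_secondDensity (k l : ℕ) :
    Measurable fun pq : (ℝ × ℝ) × (ℝ × ℝ) => (k : ℝ) / (2 * π) * (l / (2 * π)) /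
        ((1 + k * |((pq.1.2.toNNReal : ℝ≥0) : ℝ) - pq.1.1.toNNReal|) *
            (1 + l * |((pq.2.2.toNNReal : ℝ≥0) : ℝ) - pq.2.1.toNNReal|) -
          k * l * incrCov pq.1.1.toNNReal pq.1.2.toNNReal pq.2.1.toNNReal pq.2.2.toNNReal ^ 2) := by
  simp only [Real.coe_toNNReal']
  refine Measurable.div measurable_const ?_
  fun_prop

/-- The second-moment density is bounded by `kl/(2π)²` (it is the expectation of a product of
two kernels each bounded by `k/2π`, `l/2π`). [folklore] -/
theorem norm_secondDensity_le [IsProbabilityMeasure P] (hZ : IsBrownianComplex Z P)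
    (hmeas : ∀ t, Measurable (Z t)) (k l : ℕ) (pq : (ℝ × ℝ) × (ℝ × ℝ)) :
    ‖(k : ℝ) / (2 * π) * (l / (2 * π)) /
        ((1 + k * |((pq.1.2.toNNReal : ℝ≥0) : ℝ) - pq.1.1.toNNReal|) *
            (1 + l * |((pq.2.2.toNNReal : ℝ≥0) : ℝ) - pq.2.1.toNNReal|) -
          k * l * incrCov pq.1.1.toNNReal pq.1.2.toNNReal pq.2.1.toNNReal pq.2.2.toNNReal ^ 2)‖ ≤
      k / (2 * π) * (l / (2 * π)) := by
  rw [← integral_kernelProc_mul hZ hmeas k l pq.1 pq.2]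
  have h := norm_integral_le_of_norm_le_const (μ := P) (C := (k : ℝ) / (2 * π) * (l / (2 * π)))
    (f := fun ω => kernelProc Z k pq.1 ω * kernelProc Z l pq.2 ω) (ae_of_all _ fun ω => by
      rw [norm_mul]
      exact mul_le_mul (norm_kernelProc_le Z k _ _) (norm_kernelProc_le Z l _ _) (norm_nonneg _)
        (by positivity))
  simpa using h

/-- **The covariance density** `Φ_{k,l}((s,t),(u,v)) = (kl/(2π)²)(1/D - 1/((1 + k|t-s|)(1 + l|v-u|)))`,
`D = (1 + k|t-s|)(1 + l|v-u|) - kl c²`, `c = incrCov s t u v` (times clamped to `ℝ≥0`):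
`Cov(g_k(Z_t - Z_s), g_l(Z_v - Z_u))` (`covariance_mollifiedSILT`). [folklore] -/
def covDensity (k l : ℕ) (pq : (ℝ × ℝ) × (ℝ × ℝ)) : ℝ :=
  (k : ℝ) / (2 * π) * (l / (2 * π)) *
    (1 / ((1 + k * |((pq.1.2.toNNReal : ℝ≥0) : ℝ) - pq.1.1.toNNReal|) *
            (1 + l * |((pq.2.2.toNNReal : ℝ≥0) : ℝ) - pq.2.1.toNNReal|) -
          k * l * incrCov pq.1.1.toNNReal pq.1.2.toNNReal pq.2.1.toNNReal pq.2.2.toNNReal ^ 2) -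
      1 / ((1 + k * |((pq.1.2.toNNReal : ℝ≥0) : ℝ) - pq.1.1.toNNReal|) *
        (1 + l * |((pq.2.2.toNNReal : ℝ≥0) : ℝ) - pq.2.1.toNNReal|)))

/-- The first-moment density `(k/2π)/(1 + k|t-s|)` is continuous, hence integrable on the unit
square. [folklore] -/
theorem continuous_meanDensity (k : ℕ) :
    Continuous fun p : ℝ × ℝ => (k : ℝ) / (2 * π) / (1 + k * |((p.2.toNNReal : ℝ≥0) : ℝ) - p.1.toNNReal|) := by
  simp only [Real.coe_toNNReal']
  refine Continuous.div continuous_const ?_ fun p => ?_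
  · fun_prop
  · positivity

/-- Bound `(k/2π)/(1 + k|t-s|) ≤ k/2π`. [folklore] -/
theorem norm_meanDensity_le (k : ℕ) (p : ℝ × ℝ) :
    ‖(k : ℝ) / (2 * π) / (1 + k * |((p.2.toNNReal : ℝ≥0) : ℝ) - p.1.toNNReal|)‖ ≤ k / (2 * π) := by
  have h0 : (0 : ℝ) ≤ k / (2 * π) := by positivity
  have h1 : (1 : ℝ) ≤ 1 + k * |((p.2.toNNReal : ℝ≥0) : ℝ) - p.1.toNNReal| := by
    have : (0 : ℝ) ≤ k * |((p.2.toNNReal : ℝ≥0) : ℝ) - p.1.toNNReal| := by positivity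
    linarith
  rw [Real.norm_eq_abs, abs_of_nonneg (div_nonneg h0 (by positivity))]
  exact div_le_self h0 h1

/-- **`Cov(T_k, T_l) = ∫_{[0,1]⁴} Φ_{k,l}`** with `Φ_{k,l} = Edwards2D.covDensity k l`
(`E[T_kT_l] - E T_k E T_l`, the second term being `∫∫ (k/2π)/(1+k|t-s|) · ∫∫ (l/2π)/(1+l|v-u|)`).
[cite: LeGall1985, §0, (0-c)] -/
theorem covariance_mollifiedSILT [IsProbabilityMeasure P] (hZ : IsBrownianComplex Z P)
    (hmeas : ∀ t, Measurable (Z t)) (hcont : ∀ ω, Continuous (Z · ω)) (k l : ℕ) :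
    cov[mollifiedSILT Z k, mollifiedSILT Z l; P] = ∫ pq, covDensity k l pq ∂(unitSq.prod unitSq) := by
  rw [covariance_eq_sub (memLp_mollifiedSILT hmeas hcont k 2) (memLp_mollifiedSILT hmeas hcont l 2)]
  rw [show (mollifiedSILT Z k * mollifiedSILT Z l) = fun ω => mollifiedSILT Z k ω * mollifiedSILT Z l ω
    from rfl, integral_mollifiedSILT_mul hZ hmeas hcont, integral_mollifiedSILT hZ hmeas hcont,
    integral_mollifiedSILT hZ hmeas hcont]
  rw [← integral_prod_mul (μ := unitSq) (ν := unitSq)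
    (fun p : ℝ × ℝ => (k : ℝ) / (2 * π) / (1 + k * |((p.2.toNNReal : ℝ≥0) : ℝ) - p.1.toNNReal|))
    (fun q : ℝ × ℝ => (l : ℝ) / (2 * π) / (1 + l * |((q.2.toNNReal : ℝ≥0) : ℝ) - q.1.toNNReal|))]
  rw [← integral_sub]
  · refine integral_congr_ae (ae_of_all _ fun pq => ?_)
    have hD := discr_pos hZ hmeas k l pq.1 pq.2
    simp only [covDensity]
    field_simp
  · exact Integrable.of_bound (measurable_secondDensity k l).aestronglyMeasurable _
      (ae_of_all _ fun pq => norm_secondDensity_le hZ hmeas k l pq)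
  · refine Integrable.of_bound ?_ (k / (2 * π) * (l / (2 * π))) (ae_of_all _ fun pq => ?_)
    · exact (((continuous_meanDensity k).comp continuous_fst).mul
        ((continuous_meanDensity l).comp continuous_snd)).aestronglyMeasurable
    · rw [norm_mul]
      exact mul_le_mul (norm_meanDensity_le k pq.1) (norm_meanDensity_le l pq.2) (norm_nonneg _)
        (by positivity)

end Measurable

end Edwards2D

end Literature.Barriers.CriticalPhenomena
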